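import Summits.BirchSwinnertonDyer.BirchSwinnertonDyer.Theorems.AdditiveKolyvaginRoadManinFrameResidueProperRTameTwistArith
import Mathlib.FieldTheory.KummerExtension
import Mathlib.RingTheory.RootsOfUnity.Complex
import HarnessLib

/-!
# Route `AdditiveKolyvaginRoad`, crux `ManinFrameResidueProperR` (stmt-BirchSwinnertonDyer-20709), line
# `birth`, stub TDS: unit Euler factors at the RESONANT multiplicative primes `ℓ ≡ ±a_ℓ (mod p)` — the two
# arithmetic lemmas that let the tame-twist lever drop every hypothesis on `(N, a_ℓ)` — `--supports`, helper

Cell `pub/bsd-wall`, seat `bsd-wall-manin-p1` g3. Pure arithmetic over `ℂ` (companion of `…RTameTwistArith`).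
The `N`-imprimitivity factor `ℓ − a ζ` (`ζ = χ(ℓ)`, `a = a_ℓ = ±1`) of Kato's twisted value is a `p`-unit:
* `exists_eulerFactor_mul_eq_of_oddOrder` (case `ℓ ≡ −a (mod p)`): if `ζⁿ = 1` with `n` ODD and prime to the
  odd primes of `p − 1`, and `ℓ/a ≢ 1 (mod p)`, then `(ℓ − aζ)·w = ℓⁿ − aⁿ` with `p ∤ ℓⁿ − aⁿ` (else
  `ord_p(ℓ/a) ∣ gcd(n, p − 1) = 1`); used with `n = (d′ − 1)/2` when `ℓ` is a square mod `d′ ≡ 3 (4)`.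
* `exists_eulerFactor_mul_eq_of_modEq` (case `ℓ ≡ a (mod p)`): if `ζⁿ = 1`, `ζ ≠ 1`, `p ∤ n`, `p ∣ ℓ − a`,
  `p ∤ a`, `ℓ ≠ a`, then `(ℓ − aζ)·w = Σ_{i<n} ℓ^i a^{n−1−i}` (`≡ n aⁿ⁻¹ ≢ 0 mod p`), where
  `w = ∏_{j ∉ {0, j₀}} (ℓ − a ζ_n^j)` comes from `Xⁿ − aⁿ = ∏_j (X − ζ_n^j a)` (Mathlib `X_pow_sub_C_eq_prod`);
  used when `−ℓ` is a square mod `d′ ≡ 3 (4)`, which forces `χ(ℓ) ≠ 1` for ODD `χ`.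
Both come with the symmetric packaging `(ℓ − aζ)(ℓ − aζ⁻¹)·w = t`, `p ∤ t`. Everything proved; no definition.
-/

set_option autoImplicit false
set_option linter.dupNamespace false

noncomputable section

open scoped Classical

open Polynomial

namespace Summit.BirchSwinnertonDyer.BirchSwinnertonDyer.Theorems.ManinFrameResidueProperRTameTwist

section OddOrder

variable {p : ℕ}

/-- **`p ∤ ℓⁿ − aⁿ` for odd `n` prime to the odd primes of `p − 1`, when `ℓ/a ≢ 1 (mod p)`**: otherwise
`ord_p(ℓ/a) ∣ gcd(n, p − 1) = 1`. [folklore] -/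
theorem not_dvd_pow_sub_pow_of_ne_one [hp : Fact p.Prime] {ℓ a : ℤ} (hℓ : ((ℓ : ZMod p)) ≠ 0)
    (hA : (ℓ : ZMod p) / (a : ZMod p) ≠ 1) {n : ℕ} (hn : n ≠ 0) (hodd : ¬ 2 ∣ n)
    (hr : ∀ r : ℕ, r.Prime → r ≠ 2 → r ∣ p - 1 → ¬ r ∣ n) : ¬ (p : ℤ) ∣ ℓ ^ n - a ^ n := by
  intro hdvd
  have h0 : ((ℓ : ZMod p)) ^ n = ((a : ZMod p)) ^ n := by
    have : (((ℓ ^ n - a ^ n : ℤ)) : ZMod p) = 0 := (ZMod.intCast_zmod_eq_zero_iff_dvd _ p).mpr hdvd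
    push_cast at this
    exact sub_eq_zero.mp this
  by_cases ha : ((a : ZMod p)) = 0
  · rw [ha, zero_pow hn] at h0
    exact pow_ne_zero n hℓ h0
  set u : ZMod p := (ℓ : ZMod p) / (a : ZMod p) with hu
  have hu1 : u ^ n = 1 := by
    rw [hu, div_pow, h0, div_self (pow_ne_zero n ha)]
  have hord_n : orderOf u ∣ n := orderOf_dvd_of_pow_eq_one hu1
  have hu0 : u ≠ 0 := by rw [hu]; exact div_ne_zero hℓ ha
  have hord_p : orderOf u ∣ p - 1 := orderOf_dvd_of_pow_eq_one (ZMod.pow_card_sub_one_eq_one hu0)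
  have hordpos : 0 < orderOf u :=
    orderOf_pos_iff.mpr (isOfFinOrder_iff_pow_eq_one.mpr ⟨n, Nat.pos_of_ne_zero hn, hu1⟩)
  -- every prime factor of `ord u` is excluded, so `ord u = 1`
  have hord1 : orderOf u = 1 := by
    by_contra h1
    obtain ⟨r, hrp, hrord⟩ := Nat.exists_prime_and_dvd h1
    by_cases hr2 : r = 2
    · subst hr2
      exact hodd (hrord.trans hord_n)
    · exact hr r hrp hr2 (hrord.trans hord_p) (hrord.trans hord_n)
  exact hA (orderOf_eq_one_iff.mp hord1)

/-- **Symmetric unit Euler factor, odd-order case** (`ℓ/a ≢ 1 (mod p)`, `ζⁿ = 1` with `n` odd and prime to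
the odd primes of `p − 1`): `(ℓ − aζ)(ℓ − aζ⁻¹)·w = t` with `w` integral, `p ∤ t ∈ ℤ`. [folklore] -/
theorem exists_symmEulerFactor_mul_eq_of_oddOrder [hp : Fact p.Prime] (ℓ : ℕ) (a : ℤ)
    (hℓ : ((ℓ : ZMod p)) ≠ 0) (hA : (ℓ : ZMod p) / (a : ZMod p) ≠ 1)
    {n : ℕ} (hn : 0 < n) (hodd : ¬ 2 ∣ n) (hr : ∀ r : ℕ, r.Prime → r ≠ 2 → r ∣ p - 1 → ¬ r ∣ n)
    {ζ : ℂ} (hζ : ζ ^ n = 1) :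
    ∃ (w : ℂ) (t : ℤ), IsIntegral ℤ w ∧
      (((ℓ : ℂ) - (a : ℂ) * ζ) * ((ℓ : ℂ) - (a : ℂ) * ζ⁻¹)) * w = t ∧ ¬ (p : ℤ) ∣ t := by
  have hℓ' : (((ℓ : ℤ) : ZMod p)) ≠ 0 := by simpa using hℓ
  have hA' : ((ℓ : ℤ) : ZMod p) / (a : ZMod p) ≠ 1 := by simpa using hA
  have hζ' : ζ⁻¹ ^ n = 1 := by rw [inv_pow, hζ, inv_one]
  obtain ⟨w₁, hw₁, he₁⟩ := exists_eulerFactor_mul_eq (ℓ : ℤ) a hn hζ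
  obtain ⟨w₂, hw₂, he₂⟩ := exists_eulerFactor_mul_eq (ℓ : ℤ) a hn hζ'
  have ht : ¬ (p : ℤ) ∣ (ℓ : ℤ) ^ n - a ^ n := not_dvd_pow_sub_pow_of_ne_one hℓ' hA' hn.ne' hodd hr
  refine ⟨w₁ * w₂, ((ℓ : ℤ) ^ n - a ^ n) * ((ℓ : ℤ) ^ n - a ^ n), hw₁.mul hw₂, ?_,
    fun hdvd ↦ ((Int.prime_iff_natAbs_prime.mpr (by simpa using hp.out)).dvd_or_dvd hdvd).elim ht ht⟩
  push_cast at he₁ he₂ ⊢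
  linear_combination ((ℓ : ℂ) - (a : ℂ) * ζ⁻¹) * w₂ * he₁ + ((ℓ : ℂ) ^ n - (a : ℂ) ^ n) * he₂

end OddOrder

section Resonant

variable {p : ℕ}

/-- **The resonant case `ℓ ≡ a (mod p)`, one factor.** If `ζⁿ = 1`, `ζ ≠ 1`, `p ∤ n`, `p ∣ ℓ − a`, `p ∤ a`
and `ℓ ≠ a`, then `(ℓ − aζ)·w = Σ_{i<n} ℓ^i a^{n−1−i}` with `w` integral and `p ∤ Σ_{i<n} ℓ^i a^{n−1−i}`
(`≡ n aⁿ⁻¹ (mod p)`): from `ℓⁿ − aⁿ = ∏_{j<n}(ℓ − ζ_n^j a)` (`ζ_n = e^{2πi/n}`, Mathlib `X_pow_sub_C_eq_prod`)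
and `ℓⁿ − aⁿ = (ℓ − a) Σ ℓ^i a^{n−1−i}`, cancelling `ℓ − a`. [folklore] -/
theorem exists_eulerFactor_mul_eq_of_modEq [hp : Fact p.Prime] (ℓ a : ℤ) (hℓa : (p : ℤ) ∣ ℓ - a)
    (ha : ¬ (p : ℤ) ∣ a) (hne : ℓ ≠ a) {n : ℕ} (hn : 0 < n) (hpn : ¬ (p : ℤ) ∣ n)
    {ζ : ℂ} (hζn : ζ ^ n = 1) (hζ1 : ζ ≠ 1) :
    ∃ (w : ℂ) (t : ℤ), IsIntegral ℤ w ∧ ((ℓ : ℂ) - a * ζ) * w = t ∧ ¬ (p : ℤ) ∣ t := by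
  haveI : NeZero n := ⟨hn.ne'⟩
  -- a primitive `n`-th root of unity and `ζ = ζ₀ ^ j`, `j ≠ 0`
  set ζ₀ : ℂ := Complex.exp (2 * Real.pi * Complex.I / n) with hζ₀def
  have hζ₀ : IsPrimitiveRoot ζ₀ n := Complex.isPrimitiveRoot_exp n hn.ne'
  obtain ⟨j, hjn, hj⟩ := hζ₀.eq_pow_of_pow_eq_one hζn
  have hj0 : j ≠ 0 := by rintro rfl; exact hζ1 (by rw [← hj, pow_zero])
  -- the product formula `ℓⁿ − aⁿ = ∏_{i<n} (ℓ − ζ₀^i a)`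
  have hprod : (ℓ : ℂ) ^ n - (a : ℂ) ^ n = ∏ i ∈ Finset.range n, ((ℓ : ℂ) - ζ₀ ^ i * a) := by
    have h := X_pow_sub_C_eq_prod hζ₀ (α := (a : ℂ)) (a := (a : ℂ) ^ n) hn rfl
    have := congrArg (fun q ↦ Polynomial.eval (ℓ : ℂ) q) h
    simpa [Polynomial.eval_prod] using this
  -- split off `i = 0` and `i = j`
  set f : ℕ → ℂ := fun i ↦ (ℓ : ℂ) - ζ₀ ^ i * a with hfdef
  have h0mem : 0 ∈ Finset.range n := Finset.mem_range.mpr hn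
  have hjmem : j ∈ (Finset.range n).erase 0 := Finset.mem_erase.mpr ⟨hj0, Finset.mem_range.mpr hjn⟩
  set w : ℂ := ∏ i ∈ ((Finset.range n).erase 0).erase j, f i with hwdef
  have hsplit : ∏ i ∈ Finset.range n, f i = f 0 * (f j * w) := by
    rw [← Finset.mul_prod_erase _ _ h0mem, ← Finset.mul_prod_erase _ _ hjmem]
  have hf0 : f 0 = (ℓ : ℂ) - a := by simp [hfdef]
  have hfj : f j = (ℓ : ℂ) - a * ζ := by rw [hfdef]; simp only; rw [hj]; ring
  -- the geometric sum
  set t : ℤ := ∑ i ∈ Finset.range n, ℓ ^ i * a ^ (n - 1 - i) with htdef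
  have hgeom : ((t : ℤ) : ℂ) * ((ℓ : ℂ) - a) = (ℓ : ℂ) ^ n - (a : ℂ) ^ n := by
    rw [htdef]; push_cast
    exact Commute.geom_sum₂_mul (Commute.all _ _) n
  have hℓa0 : (ℓ : ℂ) - a ≠ 0 := by
    rw [sub_ne_zero]; exact_mod_cast hne
  refine ⟨w, t, ?_, ?_, ?_⟩
  · -- `w` is integral
    rw [hwdef]
    refine IsIntegral.prod _ fun i _ ↦ ?_
    rw [hfdef]
    exact (isIntegral_algebraMap (x := ℓ)).sub
      (((hζ₀.isIntegral hn).pow _).mul (isIntegral_algebraMap (x := a)))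
  · -- `(ℓ − aζ) w = t`: cancel `ℓ − a`
    have h1 : ((ℓ : ℂ) - a) * (((ℓ : ℂ) - a * ζ) * w) = ((ℓ : ℂ) - a) * t := by
      rw [← hfj, ← hf0, ← hsplit, ← hprod, ← hgeom]; ring
    exact mul_left_cancel₀ hℓa0 h1
  · -- `t ≡ n aⁿ⁻¹ (mod p)`
    intro hpt
    have hmod : ((t : ℤ) : ZMod p) = (n : ZMod p) * ((a : ZMod p)) ^ (n - 1) := by
      rw [htdef]; push_cast
      have hla : ((ℓ : ZMod p)) = (a : ZMod p) := by
        have := (ZMod.intCast_eq_intCast_iff_dvd_sub a ℓ p).mpr (by simpa using hℓa)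
        exact this.symm
      rw [Finset.sum_congr rfl fun i hi ↦ by
        rw [hla, ← pow_add, show i + (n - 1 - i) = n - 1 from by
          have := Finset.mem_range.mp hi; omega]]
      rw [Finset.sum_const, Finset.card_range, nsmul_eq_mul]
    have hzero : ((t : ℤ) : ZMod p) = 0 := (ZMod.intCast_zmod_eq_zero_iff_dvd _ p).mpr hpt
    rw [hzero] at hmod
    have ha0 : ((a : ZMod p)) ≠ 0 := fun h ↦ ha ((ZMod.intCast_zmod_eq_zero_iff_dvd _ p).mp h)
    have hn0 : ((n : ZMod p)) ≠ 0 := fun h ↦ hpn (by exact_mod_cast (ZMod.natCast_eq_zero_iff n p).mp h)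
    exact mul_ne_zero hn0 (pow_ne_zero _ ha0) hmod.symm

/-- **Symmetric packaging, resonant case**: with `ζ` and `ζ⁻¹` (both `≠ 1`, both `n`-th roots of unity).
[folklore] -/
theorem exists_symmEulerFactor_mul_eq_of_modEq [hp : Fact p.Prime] (ℓ : ℕ) (a : ℤ)
    (hℓa : (p : ℤ) ∣ (ℓ : ℤ) - a) (ha : ¬ (p : ℤ) ∣ a) (hne : (ℓ : ℤ) ≠ a) {n : ℕ} (hn : 0 < n)
    (hpn : ¬ (p : ℤ) ∣ n) {ζ : ℂ} (hζn : ζ ^ n = 1) (hζ1 : ζ ≠ 1) :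
    ∃ (w : ℂ) (t : ℤ), IsIntegral ℤ w ∧
      (((ℓ : ℂ) - (a : ℂ) * ζ) * ((ℓ : ℂ) - (a : ℂ) * ζ⁻¹)) * w = t ∧ ¬ (p : ℤ) ∣ t := by
  have hζn' : ζ⁻¹ ^ n = 1 := by rw [inv_pow, hζn, inv_one]
  have hζ1' : ζ⁻¹ ≠ 1 := fun h ↦ hζ1 (inv_eq_one.mp h)
  obtain ⟨w₁, t₁, hw₁, he₁, ht₁⟩ := exists_eulerFactor_mul_eq_of_modEq (ℓ : ℤ) a hℓa ha hne hn hpn hζn hζ1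
  obtain ⟨w₂, t₂, hw₂, he₂, ht₂⟩ :=
    exists_eulerFactor_mul_eq_of_modEq (ℓ : ℤ) a hℓa ha hne hn hpn hζn' hζ1'
  refine ⟨w₁ * w₂, t₁ * t₂, hw₁.mul hw₂, ?_, fun hdvd ↦ ((Int.prime_iff_natAbs_prime.mpr
    (by simpa using hp.out)).dvd_or_dvd hdvd).elim ht₁ ht₂⟩
  push_cast at he₁ he₂ ⊢
  linear_combination ((ℓ : ℂ) - (a : ℂ) * ζ⁻¹) * w₂ * he₁ + (t₁ : ℂ) * he₂

end Resonant

end Summit.BirchSwinnertonDyer.BirchSwinnertonDyer.Theorems.ManinFrameResidueProperRTameTwist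

end
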